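import Summits.Ventures.HSemireg.Pad4TowerLineLetters

/-!
# PAD-4 on 𝔅(μ₄): (M) — on a LINE configuration the class screen (A1) kills every top mixed moment except `ββββ`, `β̄β̄β̄β̄` —,
# the Hall flows, and the two-term law in the KERNEL orientation (HSemireg support file; phase-torus line, stage 3, module 2 of 3)

Crux of record: `Summit.HodgeConjecture.HodgeConjecture.Theses.EightfoldBlochSeeds.BlochSeedDiscOne`
(= `HasHyperbolicBlochSeed 4 1`, item stmt-HodgeConjecture-18881; skeleton `Lines/birth.lean`, STUB R `stub_rung_pad4_seedAt`,
named technique = PAD-4 two-level ⊕-block design with a TWO-TERM line-bundle presentation).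
Nothing in this file proves HC, HC_AV, HC_CM, H2 or item 18881; census-neutral (no SAT∕UNSAT row is added or changed).

WHAT THIS FILE IS (second of three; tree copy of §1b + §2 + §3 + §4-DOWN of the crux workfile `Cruxes/BlochSeedDiscOne/LinePhaseTorus.lean`
7bccd0589afd5c59 (these sections byte-identical in ab02e47f9363010f); statements control g5; bodies: §1b + `topMoment_eq_zero_of_classScreen`
hsemireg-phasetorus-typer-1 g0, `wch_eWord_eq_moment_beta` + `lineTwoTermDown_mu_eq_zero` control g5): the direction (M) of the phase-torus
dictionary that the two-term law needs, the flows, and the law in the DOWN orientation —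
* §1b SLOT CALCULUS.  Every moment letter is a two-term combination of CLASS letters of the same factor: `1 = [1]`,
  `c = h·[1] − [u]` (by the definition of `lineCharge`; no line hypothesis), `β = [e]`, `β̄ = [ē]` (`slotCoef`, `slotLetter`,
  `mletter_eq_slot`).  Hence `mono(Z, m) = Σ_{x : Fin 4 → Fin 2} A(x)·ch(Z)(W x)` (`mono_eq_sum_slot`, `Fintype.prod_sum`) and
  `moment m = Σ_x A(x)·wch(W x)` (`moment_eq_sum_slot`).  If `m` carries a `β` or `β̄` letter and is not `ββββ`, `β̄β̄β̄β̄`, EVERY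
  class word `W x` is e-mixed and differs from `eeee`, `ēēēē` (`slotWord_not_eFree`, `slotWord_ne_eWord`, `slotWord_ne_ebarWord`),
  so clause (i) of the class screen kills each term: **`moment_eq_zero_of_beta`** (for EVERY configuration, top word or not — the
  `2^{#u}` words of the `u`-expansion die one by one; no triangular elimination, no induction).  The remaining top word `cccc`
  is the Ψ-row: on a LINE cell `12Ψ = 12·Π_f c_f` (`psi12_of_lineCell`, LEMMA Ψ-LINE — cf. `Pad4TowerPsiLine.MCell.psi12_ceiling`)
  and `Λ₁₂(wch) = 0` under (A1) (`Pad4TowerClassScreen.lamTwelve_eq_zero_of_classScreen`, `Pad4TowerPsiSubA1.MCell.lamTwelve_ch`),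
  so `12·N(cccc) = 0`: **`moment_cccc_eq_zero`** — Λ is the degree-2 → 3 → 4 elimination packaged as one e-free annihilator.
* §2 (M): `wch_eWord_eq_moment_beta` (`μ = wch(eeee)` IS the `ββββ` moment) and **`topMoment_eq_zero_of_classScreen`**: on a
  LINE configuration passing (A1), every TOP moment word (no unit letter) other than `ββββ`, `β̄β̄β̄β̄` has moment `0`.
* §3 FLOWS (König–Egerváry form of the generic-rank condition «rank ≤ term rank» of a two-term presentation, for EVERY map):
  `UpFlow C mN mP` (P-saturating flow along live pairs `P ≤ N`, N-capacities `m_N`; cokernel presentation `⊕P → ⊕N → 𝓔 → 0`),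
  `DownFlow` (pairs `N ≤ P`; kernel presentation `0 → 𝓔 → ⊕N → ⊕P`), `UpFlow.residual`.
* §4 **`lineTwoTermDown_mu_eq_zero`** — THE LAW IN THE KERNEL ORIENTATION, EVERY RANK: a LINE configuration (all cells `LineCell h`,
  multiplicities `m ≥ 0`) passing (A1) with a P-saturating down flow has `μ = C.wch mN mP eeee = 0` (flow decomposition
  `Σ m_N g(N) − Σ m_P g(P) = Σ_N (r(N) g(N) + Σ_P π(N,P)(g(N) − g(P)))`; with `g = V` = charge product every term is `≥ 0` by the slide
  lemma and the sum is `N(cccc) = 0` by (M), so every term dies; the same decomposition of `μ = N(ββββ)` then dies term by term).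
Everything here is PROVED (axioms `propext`, `Classical.choice`, `Quot.sound`; no `sorry`, no named fact, no instance, no notation).
Pen counterpart: memo `Cruxes/BlochSeedDiscOne/PHASE-TORUS-LAW-g5.md` v1.1 §1 (live pairs, flows), §2 (M) («(H1) ⟺ all mixed moments with
|S| ≥ 2 vanish except ββββ = μ, β̄β̄β̄β̄ = μ̄»; here the direction ⇒ for top words, which is what the law uses) and §2 DOWN; ×2 idea-crit-6 g10.

WHAT IT IS NOT: the converse direction of (M), anything about non-LINE letters (`a + c < h`), monads (C3ᴹ), ≥ 3-term complexes, the
semi-homogeneous alphabet, a SOURCE or a SEED; «live pair» (`MCell.le`, classes) over-approximates `Hom ≠ 0`, which only weakens the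
hypothesis.  The UP (cokernel) orientation at corank ≤ 4 ∕ ≤ 7 via the torus-form laws `PhaseTorusLawProof.phaseTorusLaw_holds` ∕
`PhaseTorusLaw7.phaseTorusLaw7_holds` is the sequel `Pad4TowerLinePhaseTorus`.
Tree filing: hsemireg-phasetorus-typer-1 g0.
-/

namespace Summit.Ventures.HSemireg.LinePhaseTorus

open Finset BigOperators Summit.Ventures.HSemireg.Pad4Tower

/-! ## §1b slot calculus for (M)

Every moment letter is a two-term combination of CLASS letters of the same factor: `1 = [1]`, `c = h·[1] − [u]` (by the
definition of `lineCharge`, no line hypothesis), `β = [e]`, `β̄ = [ē]`.  Hence the monomial of a cell at a moment word `m`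
is the expansion `Σ_{x : Fin 4 → Fin 2} A(x) · ch(Z)(W x)` over slot choices (`Fintype.prod_sum`), and the design moment is
`Σ_x A(x) · wch(W x)`.  If `m` carries a `β` or `β̄` letter and is not `ββββ`, `β̄β̄β̄β̄`, EVERY class word `W x` is e-mixed
and differs from `eeee`, `ēēēē`, so (A1)(i) kills each term: the `2^{#u}` words of the `u`-expansion die one by one (no
triangular elimination, no induction).  The remaining top word `cccc` is the Ψ-row: on a LINE cell `12Ψ = 12·Π_f c_f`
(LEMMA Ψ-LINE, cf. `Pad4TowerPsiLine.MCell.psi12_ceiling`), and `Λ₁₂(wch) = 0` under (A1) (`lamTwelve_eq_zero_of_classScreen`,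
`MCell.lamTwelve_ch`) — Λ is the degree-2 → 3 → 4 elimination packaged as one e-free annihilator. -/

/-- coefficients of the two-term slot decomposition of the moment letters `0,1,2,3 = 1, c, β, β̄`:
`1 = 1·[1] + 0`, `c = h·[1] − 1·[u]`, `β = 1·[e] + 0`, `β̄ = 1·[ē] + 0`. -/
def slotCoef (h : ℤ) : Fin 4 → Fin 2 → GaussianInt :=
  ![![1, 0], ![(h : GaussianInt), -1], ![1, 0], ![1, 0]]

/-- class letters (`0..5 = 1, u, v, e, ē, p`) of the two-term slot decomposition of the moment letters. -/
def slotLetter : Fin 4 → Fin 2 → Fin 6 :=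
  ![![0, 0], ![0, 1], ![3, 3], ![4, 4]]

/-- the CLASS WORD of the slot choice `x` at the moment word `m`. -/
def slotWord (m : Fin 4 → Fin 4) (x : Fin 4 → Fin 2) : CWord := fun f => slotLetter (m f) (x f)

/-- the coefficient `A(x) = Π_f a(m_f, x_f)` of the slot choice `x` at the moment word `m`. -/
def slotA (h : ℤ) (m : Fin 4 → Fin 4) (x : Fin 4 → Fin 2) : GaussianInt := ∏ f, slotCoef h (m f) (x f)

/-- the `1`-slot of a letter vector is `1`. -/
theorem bphi_zero (x : BPoint) : bphi x 0 = 1 := by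
  simp [bphi, phiVec]

/-- the `u`-slot of a letter vector is `α`. -/
theorem bphi_one (x : BPoint) : bphi x 1 = (x.1 : GaussianInt) := by
  simp [bphi, phiVec]

/-- the `e`-slot of a letter vector is `β`. -/
theorem bphi_three (x : BPoint) : bphi x 3 = ⟨x.2.1, x.2.2⟩ := by
  simp only [bphi, phiVec]
  simp only [Matrix.cons_val]

/-- the `ē`-slot of a letter vector is `β̄`. -/
theorem bphi_four (x : BPoint) : bphi x 4 = ⟨x.2.1, -x.2.2⟩ := by
  simp only [bphi, phiVec]
  simp only [Matrix.cons_val]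

/-- THE SLOT DECOMPOSITION of every moment letter (no line hypothesis: `c := h − α` by definition). -/
theorem mletter_eq_slot (h : ℤ) (Z : MCell) (f : Fin 4) (l : Fin 4) :
    mletter h Z f l = ∑ j : Fin 2, slotCoef h l j * bphi (Z f) (slotLetter l j) := by
  fin_cases l
  · simp [mletter, slotCoef, slotLetter, Fin.sum_univ_two, bphi_zero]
  · simp only [mletter, slotCoef, slotLetter, Fin.sum_univ_two, lineCharge]
    simp only [Fin.mk_one, Fin.isValue, Matrix.cons_val_one, Matrix.cons_val_zero, Matrix.cons_val_fin_one,
      Int.cast_sub, bphi_zero, bphi_one]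
    ring
  · simp only [mletter, slotCoef, slotLetter, Fin.sum_univ_two, betaG]
    simp [bphi_three]
  · simp only [mletter, slotCoef, slotLetter, Fin.sum_univ_two, betaG]
    simp [bphi_four]

/-- the class tensor of a cell as a product over the factors. -/
theorem ch_eq_prod (Z : MCell) (w : CWord) : Z.ch w = ∏ f, bphi (Z f) (w f) := by
  simp only [MCell.ch, chTensor, Fin.prod_univ_four]

/-- the monomial of a cell at `m` is the slot expansion of its class tensor. -/
theorem mono_eq_sum_slot (h : ℤ) (Z : MCell) (m : Fin 4 → Fin 4) :
    MCell.mono h Z m = ∑ x : Fin 4 → Fin 2, slotA h m x * Z.ch (slotWord m x) := by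
  unfold MCell.mono
  simp_rw [mletter_eq_slot]
  rw [Fintype.prod_sum]
  refine Finset.sum_congr rfl fun x _ => ?_
  rw [Finset.prod_mul_distrib, ch_eq_prod]
  rfl

/-- the design moment at `m` is the slot expansion of the weighted class tensor. -/
theorem moment_eq_sum_slot (h : ℤ) (C : MConfig) (mN mP : MCell → ℤ) (m : Fin 4 → Fin 4) :
    moment h C mN mP m = ∑ x : Fin 4 → Fin 2, slotA h m x * C.wch mN mP (slotWord m x) := by
  simp only [moment, mono_eq_sum_slot, MConfig.wch, Pi.sub_apply, Finset.sum_apply, Pi.smul_apply]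
  simp only [zsmul_eq_mul, Finset.mul_sum, mul_sub, Finset.sum_sub_distrib]
  congr 1
  · rw [Finset.sum_comm]
    exact Finset.sum_congr rfl fun _ _ => Finset.sum_congr rfl fun _ _ => by ring
  · rw [Finset.sum_comm]
    exact Finset.sum_congr rfl fun _ _ => Finset.sum_congr rfl fun _ _ => by ring

/-- a `β`/`β̄` letter of `m` makes every slot word e-mixed. -/
theorem slotWord_not_eFree {m : Fin 4 → Fin 4} {f : Fin 4} (hf : m f = 2 ∨ m f = 3) (x : Fin 4 → Fin 2) :
    ¬ EFree (slotWord m x) := by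
  intro hE
  have hEf : slotLetter (m f) (x f) ≠ 3 ∧ slotLetter (m f) (x f) ≠ 4 := hE f
  rcases hf with e | e
  · have h3 : ∀ j : Fin 2, slotLetter 2 j = 3 := by decide
    rw [e] at hEf
    exact hEf.1 (h3 _)
  · have h4 : ∀ j : Fin 2, slotLetter 3 j = 4 := by decide
    rw [e] at hEf
    exact hEf.2 (h4 _)

/-- only `ββββ` has the slot word `eeee`. -/
theorem slotWord_ne_eWord {m : Fin 4 → Fin 4} (hb : m ≠ fun _ => 2) (x : Fin 4 → Fin 2) :
    slotWord m x ≠ eWord := by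
  intro hx
  apply hb
  funext f
  have e : slotLetter (m f) (x f) = eWord f := congrFun hx f
  have h3 : ∀ g : Fin 4, eWord g = 3 := by decide
  have key : ∀ (l : Fin 4) (j : Fin 2), slotLetter l j = 3 → l = 2 := by decide
  exact key _ _ (e.trans (h3 f))

/-- only `β̄β̄β̄β̄` has the slot word `ēēēē`. -/
theorem slotWord_ne_ebarWord {m : Fin 4 → Fin 4} (hbb : m ≠ fun _ => 3) (x : Fin 4 → Fin 2) :
    slotWord m x ≠ ebarWord := by
  intro hx
  apply hbb
  funext f
  have e : slotLetter (m f) (x f) = ebarWord f := congrFun hx f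
  have h4 : ∀ g : Fin 4, ebarWord g = 4 := by decide
  have key : ∀ (l : Fin 4) (j : Fin 2), slotLetter l j = 4 → l = 3 := by decide
  exact key _ _ (e.trans (h4 f))

/-- **β-WORDS** (most of (M), and more: non-top words too): under (A1)(i) every moment word with a `β` or `β̄` letter,
other than `ββββ` and `β̄β̄β̄β̄`, has vanishing design moment — for EVERY configuration (no line hypothesis: the identity
`c = h·[1] − [u]` is the definition of the charge). -/
theorem moment_eq_zero_of_beta (h : ℤ) (C : MConfig) (mN mP : MCell → ℤ) (hA1 : ClassScreen (C.wch mN mP))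
    (m : Fin 4 → Fin 4) {f : Fin 4} (hf : m f = 2 ∨ m f = 3) (hb : m ≠ fun _ => 2) (hbb : m ≠ fun _ => 3) :
    moment h C mN mP m = 0 := by
  rw [moment_eq_sum_slot]
  refine Finset.sum_eq_zero fun x _ => ?_
  rw [hA1.1 _ (slotWord_not_eFree hf x) (slotWord_ne_eWord hb x) (slotWord_ne_ebarWord hbb x), mul_zero]

/-- LEMMA Ψ-LINE in charge form (local; cf. `Pad4TowerPsiLine.MCell.psi12_ceiling`): on a LINE cell every pair term of
`12Ψ` is `2 c_f c_g` (`|β_f|² = c_f²`, `α_f − α_g = c_g − c_f`), so `12Ψ(Z) = 12·Π_f c_f`. -/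
theorem psi12_of_lineCell {h : ℤ} {Z : MCell} (hZ : LineCell h Z) : Z.psi12 = 12 * ∏ f, lineCharge h Z f := by
  have hα : ∀ f, (Z f).1 = h - lineCharge h Z f := fun f => by simp [lineCharge]
  have hs : ∀ f, (Z f).2.1 ^ 2 + (Z f).2.2 ^ 2 = lineCharge h Z f ^ 2 := fun f => by
    obtain ⟨c, k, e⟩ := hZ f
    rw [lineCharge_of_eq e, e]
    fin_cases k <;> simp [lineLetter]
  simp only [MCell.psi12, psiTwelve, hs, hα, Fin.prod_univ_four]
  ring

/-- **`cccc`**: on a LINE configuration passing (A1) the charge-product moment vanishes — `12·N(cccc) = Λ₁₂(wch) = 0`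
(the Ψ-row `MConfig.psiRow_of_classScreen` read through LEMMA Ψ-LINE). -/
theorem moment_cccc_eq_zero (h : ℤ) (C : MConfig) (mN mP : MCell → ℤ)
    (hline : ∀ Z ∈ C.lower ∪ C.upper, LineCell h Z) (hA1 : ClassScreen (C.wch mN mP)) :
    moment h C mN mP (fun _ => 1) = 0 := by
  have h0 := lamTwelve_eq_zero_of_classScreen _ hA1
  simp only [MConfig.wch, map_sub, map_sum, map_zsmul, MCell.lamTwelve_ch] at h0
  have hL : ∀ Z ∈ C.lower, ((Z.psi12 : ℤ) : GaussianInt) = 12 * MCell.mono h Z (fun _ => 1) := fun Z hZ => by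
    rw [psi12_of_lineCell (hline Z (Finset.mem_union_left _ hZ)), mono_one]
    push_cast
    ring
  have hU : ∀ P ∈ C.upper, ((P.psi12 : ℤ) : GaussianInt) = 12 * MCell.mono h P (fun _ => 1) := fun P hP => by
    rw [psi12_of_lineCell (hline P (Finset.mem_union_right _ hP)), mono_one]
    push_cast
    ring
  have h1 : ∑ Z ∈ C.lower, mN Z • ((12 : GaussianInt) * MCell.mono h Z (fun _ => 1)) -
      ∑ P ∈ C.upper, mP P • ((12 : GaussianInt) * MCell.mono h P (fun _ => 1)) = 0 := by
    rw [← h0]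
    congr 1
    · exact Finset.sum_congr rfl fun Z hZ => by rw [hL Z hZ]
    · exact Finset.sum_congr rfl fun P hP => by rw [hU P hP]
  have h12 : (12 : GaussianInt) * moment h C mN mP (fun _ => 1) = 0 := by
    rw [← h1, moment, mul_sub, Finset.mul_sum, Finset.mul_sum]
    simp only [mul_smul_comm]
  exact (mul_eq_zero.mp h12).resolve_left (by decide)

/-! ## §2 (M): on the line, (A1) kills every top mixed moment except `ββββ`, `β̄β̄β̄β̄` -/

/-- `μ` is the `ββββ` moment: the `eeee`-coefficient of the weighted class tensor (cf. `Design.ch_eWord`; e-slot `= β`). -/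
theorem wch_eWord_eq_moment_beta (h : ℤ) (C : MConfig) (mN mP : MCell → ℤ) :
    C.wch mN mP eWord = moment h C mN mP (fun _ => 2) := by
  simp only [MConfig.wch, moment, Pi.sub_apply, Finset.sum_apply, Pi.smul_apply, ch_eWord, mono_two]

/-- **(M)** (the direction used by the law): LINE + (A1) ⇒ all top mixed moments vanish except `ββββ`, `β̄β̄β̄β̄`.
(Pen: `e^{−hH}·ch` has no `p`-letter on the line, and `H^k`, `k ≥ 2`, have independent non-zero `p`-parts.  Kernel route
(§1b): a β-word dies term by term under clause (i) of the screen after the slot expansion `c = h·[1] − [u]`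
(`moment_eq_zero_of_beta`); `cccc` is the Ψ-row `Λ₁₂(wch) = 0` read through LEMMA Ψ-LINE (`moment_cccc_eq_zero`).) -/
theorem topMoment_eq_zero_of_classScreen (h : ℤ) (C : MConfig) (mN mP : MCell → ℤ)
    (hline : ∀ Z ∈ C.lower ∪ C.upper, LineCell h Z) (hA1 : ClassScreen (C.wch mN mP))
    (w : Fin 4 → Fin 4) (hw : TopWord w) (hb : w ≠ fun _ => 2) (hbb : w ≠ fun _ => 3) :
    moment h C mN mP w = 0 := by
  by_cases hc : w = fun _ => 1
  · -- the `cccc` row: the Ψ-row on the line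
    subst hc
    exact moment_cccc_eq_zero h C mN mP hline hA1
  · -- otherwise some letter is `β` or `β̄`: a β-word, killed term by term by (A1)(i)
    have hβ : ∃ f, w f = 2 ∨ w f = 3 := by
      by_contra hne
      push Not at hne
      apply hc
      funext f
      have key : ∀ l : Fin 4, l ≠ 0 → l ≠ 2 → l ≠ 3 → l = 1 := by decide
      exact key _ (hw f) (hne f).1 (hne f).2
    obtain ⟨f, hf⟩ := hβ
    exact moment_eq_zero_of_beta h C mN mP hA1 w hf hb hbb

/-! ## §3 flows (König–Egerváry form of the generic-rank condition) -/

/-- a P-SATURATING UP FLOW: `π P N` units from the `P`-cell `P` to the `N`-cell `N` along live pairs `P ≤ N`,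
every `P`-cell fully matched, `N`-capacities respected (cokernel presentation `⊕P → ⊕N → 𝓔 → 0` of generic rank `Σ m_P`). -/
structure UpFlow (C : MConfig) (mN mP : MCell → ℤ) where
  /-- flow value on the ordered pair (P-cell, N-cell) -/
  π : MCell → MCell → ℕ
  live : ∀ P N, π P N ≠ 0 → P ∈ C.upper ∧ N ∈ C.lower ∧ MCell.le P N
  sat : ∀ P ∈ C.upper, (∑ N ∈ C.lower, (π P N : ℤ)) = mP P
  cap : ∀ N ∈ C.lower, (∑ P ∈ C.upper, (π P N : ℤ)) ≤ mN N

/-- a P-SATURATING DOWN FLOW: pairs `N ≤ P` (kernel presentation `0 → 𝓔 → ⊕N → ⊕P`, `⊕N → ⊕P` of generic rank `Σ m_P`). -/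
structure DownFlow (C : MConfig) (mN mP : MCell → ℤ) where
  /-- flow value on the ordered pair (N-cell, P-cell) -/
  π : MCell → MCell → ℕ
  live : ∀ N P, π N P ≠ 0 → N ∈ C.lower ∧ P ∈ C.upper ∧ MCell.le N P
  sat : ∀ P ∈ C.upper, (∑ N ∈ C.lower, (π N P : ℤ)) = mP P
  cap : ∀ N ∈ C.lower, (∑ P ∈ C.upper, (π N P : ℤ)) ≤ mN N

/-- the residual multiplicity of an `N`-cell under an up flow. -/
def UpFlow.residual {C : MConfig} {mN mP : MCell → ℤ} (F : UpFlow C mN mP) (N : MCell) : ℤ :=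
  mN N - ∑ P ∈ C.upper, (F.π P N : ℤ)

/-! ## §4 the law at design level -/

/-- **DOWN (kernel orientation), every rank**: a LINE configuration passing (A1) with a P-saturating down flow has `μ = 0`
(transport weights `W ≥ 0`, `Σ W = N(cccc) = 0`). -/
theorem lineTwoTermDown_mu_eq_zero (h : ℤ) (C : MConfig) (mN mP : MCell → ℤ)
    (_hmN : ∀ Z, 0 ≤ mN Z) (_hmP : ∀ P, 0 ≤ mP P)
    (hline : ∀ Z ∈ C.lower ∪ C.upper, LineCell h Z) (hA1 : ClassScreen (C.wch mN mP))
    (F : DownFlow C mN mP) : C.wch mN mP eWord = 0 := by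
  classical
  have hL : ∀ Z ∈ C.lower, LineCell h Z := fun Z hZ => hline Z (Finset.mem_union_left _ hZ)
  have hU : ∀ P ∈ C.upper, LineCell h P := fun P hP => hline P (Finset.mem_union_right _ hP)
  set v : MCell → ℤ := fun Z => ∏ f, lineCharge h Z f with hv
  set b : MCell → GaussianInt := fun Z => ∏ f, betaG Z f with hb
  set r : MCell → ℤ := fun Z => mN Z - ∑ P ∈ C.upper, (F.π Z P : ℤ) with hr
  have hr0 : ∀ Z ∈ C.lower, 0 ≤ r Z := fun Z hZ => sub_nonneg.mpr (F.cap Z hZ)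
  -- (1) the `cccc` moment vanishes (the one instance of (M) used), as an integer identity
  have hM : (∑ Z ∈ C.lower, mN Z * v Z) - ∑ P ∈ C.upper, mP P * v P = 0 := by
    have h0 := topMoment_eq_zero_of_classScreen h C mN mP hline hA1 (fun _ => 1)
      (by unfold TopWord; decide) (by decide) (by decide)
    simp only [moment, mono_one, zsmul_eq_mul] at h0
    exact_mod_cast h0
  -- (2) flow decomposition of any weighted difference
  have hdec : ∀ {R : Type} [CommRing R] (g : MCell → R),
      (∑ Z ∈ C.lower, (mN Z : R) * g Z) - ∑ P ∈ C.upper, (mP P : R) * g P =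
        ∑ Z ∈ C.lower, ((r Z : R) * g Z + ∑ P ∈ C.upper, (F.π Z P : R) * (g Z - g P)) := by
    intro R _ g
    have hs : ∑ P ∈ C.upper, (mP P : R) * g P = ∑ P ∈ C.upper, ∑ Z ∈ C.lower, (F.π Z P : R) * g P := by
      refine Finset.sum_congr rfl fun P hP => ?_
      rw [← Finset.sum_mul]
      congr 1
      have := F.sat P hP
      rw [← this]; push_cast; rfl
    have hpt : ∀ Z, (r Z : R) * g Z + ∑ P ∈ C.upper, (F.π Z P : R) * (g Z - g P) =
        (mN Z : R) * g Z - ∑ P ∈ C.upper, (F.π Z P : R) * g P := by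
      intro Z
      simp only [hr, mul_sub, Finset.sum_sub_distrib, ← Finset.sum_mul]
      push_cast
      ring
    rw [Finset.sum_congr rfl fun Z _ => hpt Z, Finset.sum_sub_distrib, hs, Finset.sum_comm]
  -- (3) every transport weight is ≥ 0 and they sum to `N(cccc) = 0`: termwise vanishing
  have hpair : ∀ Z ∈ C.lower, ∀ P ∈ C.upper, 0 ≤ (F.π Z P : ℤ) * (v Z - v P) := by
    intro Z hZ P hP
    by_cases h0 : F.π Z P = 0
    · simp [h0]
    · obtain ⟨-, -, hle⟩ := F.live Z P h0
      exact mul_nonneg (by exact_mod_cast Nat.zero_le _) (sub_nonneg.mpr (v_le (hL Z hZ) (hU P hP) hle))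
  have hsum : ∑ Z ∈ C.lower, (r Z * v Z + ∑ P ∈ C.upper, (F.π Z P : ℤ) * (v Z - v P)) = 0 := by
    have := hdec (R := ℤ) v
    push_cast at this
    rw [← this]; exact hM
  have hZ0 := (Finset.sum_eq_zero_iff_of_nonneg fun Z hZ =>
    add_nonneg (mul_nonneg (hr0 Z hZ) (v_nonneg (hL Z hZ))) (Finset.sum_nonneg (hpair Z hZ))).mp hsum
  have hres : ∀ Z ∈ C.lower, r Z * v Z = 0 ∧ ∀ P ∈ C.upper, (F.π Z P : ℤ) * (v Z - v P) = 0 := by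
    intro Z hZ
    have e := hZ0 Z hZ
    have a0 : 0 ≤ r Z * v Z := mul_nonneg (hr0 Z hZ) (v_nonneg (hL Z hZ))
    have b0 : 0 ≤ ∑ P ∈ C.upper, (F.π Z P : ℤ) * (v Z - v P) := Finset.sum_nonneg (hpair Z hZ)
    have a1 : r Z * v Z = 0 := by linarith
    refine ⟨a1, ?_⟩
    have b1 : ∑ P ∈ C.upper, (F.π Z P : ℤ) * (v Z - v P) = 0 := by linarith
    exact (Finset.sum_eq_zero_iff_of_nonneg (hpair Z hZ)).mp b1
  -- (4) the same decomposition for `μ = N(ββββ)`; every term dies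
  rw [wch_eWord_eq_moment_beta h]
  have hgoal : (∑ Z ∈ C.lower, (mN Z : GaussianInt) * b Z) - ∑ P ∈ C.upper, (mP P : GaussianInt) * b P = 0 := by
    rw [hdec (R := GaussianInt) b]
    refine Finset.sum_eq_zero fun Z hZ => ?_
    obtain ⟨h1, h2⟩ := hres Z hZ
    have t1 : (r Z : GaussianInt) * b Z = 0 := by
      rcases mul_eq_zero.mp h1 with h | h
      · simp [h]
      · rw [hb]; simp only; rw [b_eq_zero_of_v (hL Z hZ) h, mul_zero]
    have t2 : ∑ P ∈ C.upper, (F.π Z P : GaussianInt) * (b Z - b P) = 0 := by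
      refine Finset.sum_eq_zero fun P hP => ?_
      by_cases h0 : F.π Z P = 0
      · simp [h0]
      · obtain ⟨-, -, hle⟩ := F.live Z P h0
        have e := h2 P hP
        rcases mul_eq_zero.mp e with h | h
        · exact absurd (by exact_mod_cast h) h0
        · have : b P = b Z := b_eq_of_v_eq (hL Z hZ) (hU P hP) hle (by linarith)
          rw [this, sub_self, mul_zero]
    rw [t1, t2, add_zero]
  simpa [moment, mono_two, zsmul_eq_mul, hb] using hgoal

end Summit.Ventures.HSemireg.LinePhaseTorus
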